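import Literature.Probability.RandomPlanarGeometry.SAWTriangularEndpointTransfer
import Literature.Probability.RandomPlanarGeometry.SAWKestenInequalityAbstractNoGrowth
import Literature.Probability.RandomPlanarGeometry.SAWTriangularDetourDensity
import Literature.Probability.RandomPlanarGeometry.SAWRatioLimitStepOne
import Literature.Probability.RandomPlanarGeometry.SAWTriangularRatioEngine
import Literature.Probability.RandomPlanarGeometry.SAWEndpointRatioLimit
import Mathlib.Analysis.SpecialFunctions.Pow.Real
import Mathlib.Analysis.Complex.ExponentialBounds
import HarnessLib

/-!
# Kesten's inequality and the ratio limit for walks of `𝕋` with a fixed endpoint, from a lower envelope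

Topic `Literature/Probability/RandomPlanarGeometry` (lane «pcv-sawmu», item «TRI-ENDPOINT»; end of the chain
`SAWTriangularEndpointMonotone` → `SAWTriangularEndpointSurgery` → `SAWTriangularEndpointTransfer` → this file).
Sources: N. Madras, G. Slade, *The Self-Avoiding Walk* (1993), Lemma 7.3.1, Theorem 7.3.2(c), Lemma 7.3.3 and
**Theorem 7.3.4(b)** (p. 248: "for every fixed nonzero `x`, `lim c_{N+2}(0,x)/c_N(0,x) = μ²`", `N` of the parity of `‖x‖₁`),
printed for `ℤ^d`; the proof of (b) uses "Lemma 7.3.1, Corollary 3.2.6, Theorem 7.3.2(c), and Lemma 7.3.3".  On `𝕋` (one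
step, no parity) the four inputs are: (i) `c_N(0,x)^{1/N} → μ(𝕋)` (Corollary 3.2.6 for `𝕋` — derived HERE from the
envelope below and `c_N(𝕋)^{1/N} → μ(𝕋)`: `tendsto_card_triSLx_rpow_of`), (ii) `c_N(0,x) ≤ 4 c_{N+1}(0,x)`
(`SAWTriangularEndpointMonotone`), (iii) Kesten's inequality, proved HERE from the interior detour surgery
(`SAWTriangularEndpointTransfer`), the all-walk detour density `detourDensityTri` and a sub-exponential LOWER ENVELOPE
`e^{−c√N} μ(𝕋)^N ≤ c_N(0,x)` for `N ≥ N₁` (hypothesis `hlo` — the ONE remaining input, the quantitative Corollary 3.2.6,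
which the lane's polygon-insertion line supplies), through the abstract `kesten_ineq_of_transfer_noGrowth`.

## Main statements (namespace `Literature.Probability.RandomPlanarGeometry.SAW`)

* `triEndpointKesten_P3_of` — (P3) for `S_N(x)` from the envelope;
* **`kestenIneqTriEndpoint_of`** — `∃ D, ∀ᶠ N, φ_N(x)² − D/N ≤ φ_N(x) φ_{N+1}(x)`, `φ_N(x) = c_{N+1}(0,x)/c_N(0,x)`, from the envelope;
* **`tendsto_card_triSLx_ratio_of`** — `c_{N+1}(0,x)/c_N(0,x) → μ(𝕋)` from the envelope and (i) (Theorem 7.3.4(b) on `𝕋`,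
  conditional form);
* `tendsto_card_triSLx_rpow_of` — (i) from the envelope; **`tendsto_card_triSLx_ratio_of_envelope`** — Theorem 7.3.4(b)
  on `𝕋` from the envelope ALONE.
-/

noncomputable section

open Finset Filter Topology Literature.Probability.LatticeModels Literature.Probability.Percolation SimpleGraph

namespace Literature.Probability.RandomPlanarGeometry.SAW

namespace TriEndpoint

/-! ### An elementary tail: `(1/2)^{⌊N/Q⌋} e^{c√N} N³ ≤ 1` eventually -/

/-- `log N ≤ 2 √N` for `N ≥ 1`. [folklore] -/
private theorem log_le_two_sqrt {N : ℝ} (hN : 1 ≤ N) : Real.log N ≤ 2 * Real.sqrt N := by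
  have hs : 0 < Real.sqrt N := Real.sqrt_pos.2 (by linarith)
  have h1 : Real.log (Real.sqrt N) ≤ Real.sqrt N - 1 := Real.log_le_sub_one_of_pos hs
  have h2 : Real.log N = 2 * Real.log (Real.sqrt N) := by
    conv_lhs => rw [← Real.mul_self_sqrt (by linarith : (0 : ℝ) ≤ N)]
    rw [Real.log_mul hs.ne' hs.ne']; ring
  rw [h2]; linarith

/-- **The tail**: for `Q ≥ 1` and `c ≥ 0` there is `N₂` with `(1/2)^{⌊N/Q⌋} · e^{c√N} · N³ ≤ 1` for all `N ≥ N₂`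
(`⌊N/Q⌋ ≥ N/Q − 1`, `log 2 > 1/2`, `log N ≤ 2√N`). [folklore] -/
private theorem exists_tail_le_one {Q : ℕ} (hQ : 0 < Q) {c : ℝ} (hc : 0 ≤ c) :
    ∃ N₂ : ℕ, ∀ N : ℕ, N₂ ≤ N → 1 ≤ N → (1 / 2 : ℝ) ^ (N / Q) * Real.exp (c * Real.sqrt N) * (N : ℝ) ^ 3 ≤ 1 := by
  have hQr : (0 : ℝ) < Q := by exact_mod_cast hQ
  -- threshold: `√N ≥ 4Q(c + 7)`
  obtain ⟨N₂, hN₂⟩ := exists_nat_ge ((4 * (Q : ℝ) * (c + 7)) ^ 2)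
  refine ⟨N₂, fun N hN hN1 => ?_⟩
  have hNr : (1 : ℝ) ≤ N := by exact_mod_cast hN1
  have hN0 : (0 : ℝ) < N := by linarith
  set s := Real.sqrt (N : ℝ) with hs
  have hs0 : 0 ≤ s := Real.sqrt_nonneg _
  have hs1 : 1 ≤ s := by rw [hs, Real.le_sqrt (by norm_num) hN0.le]; simpa using hNr
  have hss : (N : ℝ) = s * s := (Real.mul_self_sqrt hN0.le).symm
  have hsge : 4 * (Q : ℝ) * (c + 7) ≤ s := by
    have h1 : (4 * (Q : ℝ) * (c + 7)) ^ 2 ≤ N := le_trans hN₂ (by exact_mod_cast hN)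
    have h0 : 0 ≤ 4 * (Q : ℝ) * (c + 7) := by positivity
    calc 4 * (Q : ℝ) * (c + 7) = Real.sqrt ((4 * (Q : ℝ) * (c + 7)) ^ 2) := (Real.sqrt_sq h0).symm
      _ ≤ s := Real.sqrt_le_sqrt h1
  -- `k = ⌊N/Q⌋ ≥ N/Q − 1`
  set k := N / Q with hk
  have hk1 : (N : ℝ) / Q - 1 ≤ k := by
    have h : N < Q * (k + 1) := Nat.lt_mul_div_succ N hQ
    have h' : (N : ℝ) < Q * ((k : ℝ) + 1) := by exact_mod_cast h
    rw [div_sub_one hQr.ne', div_le_iff₀ hQr]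
    linarith
  -- write everything as exponentials
  have hlog2 : (1 / 2 : ℝ) < Real.log 2 := by
    have := Real.log_two_gt_d9; linarith
  have hpow : (1 / 2 : ℝ) ^ k = Real.exp (-(k * Real.log 2)) := by
    rw [one_div, inv_pow, Real.exp_neg, Real.exp_nat_mul, Real.exp_log (by norm_num : (0 : ℝ) < 2)]
  have hcube : (N : ℝ) ^ 3 = Real.exp (3 * Real.log N) := by
    rw [show (3 : ℝ) * Real.log N = ((3 : ℕ) : ℝ) * Real.log N by norm_num, Real.exp_nat_mul, Real.exp_log hN0]
  rw [hpow, hcube, ← Real.exp_add, ← Real.exp_add]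
  refine Real.exp_le_one_iff.2 ?_
  have hlogN : Real.log N ≤ 2 * s := log_le_two_sqrt hNr
  have hk0 : (0 : ℝ) ≤ k := Nat.cast_nonneg _
  -- main inequality: `k log 2 ≥ (N/Q − 1)/2 ≥ (c + 6) s`
  have hmain : c * s + 3 * (2 * s) ≤ ((N : ℝ) / Q - 1) * (1 / 2) := by
    have hsQ : 4 * (c + 7) ≤ s / Q := by rw [le_div_iff₀ hQr]; linarith
    have h1 : 4 * (c + 7) * s ≤ (N : ℝ) / Q := by
      rw [hss]
      calc 4 * (c + 7) * s ≤ s / Q * s := mul_le_mul_of_nonneg_right hsQ hs0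
        _ = s * s / Q := by ring
    nlinarith [mul_nonneg hc hs0, h1, hs1]
  have h1 : (k : ℝ) * (1 / 2) ≤ k * Real.log 2 := mul_le_mul_of_nonneg_left hlog2.le hk0
  have h2 : ((N : ℝ) / Q - 1) * (1 / 2) ≤ (k : ℝ) * (1 / 2) := mul_le_mul_of_nonneg_right hk1 (by norm_num)
  linarith [hlogN, hmain, h1, h2]

end TriEndpoint

open TriEndpoint

/-! ### (P3) for the fixed-endpoint family, from a lower envelope -/

/-- **(P3) for `S_N(x)` from a lower envelope**: if `e^{−c√N} μ(𝕋)^N ≤ c_N(0,x)` for `N ≥ N₁`, then with `a = 1/(4Q)`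
from the all-walk detour density, the walks of `S_N(x)` with fewer than `aN` sharp turns number at most `C · c_N(0,x)/N³`
for `N` large. [cite: MadrasSlade1993, §7.3 (7.3.9)–(7.3.12) and Theorem 7.3.2(c)] -/
theorem triEndpointKesten_P3_of (x : Site 2) {c : ℝ} (hc : 0 ≤ c) {N₁ : ℕ}
    (hlo : ∀ N : ℕ, N₁ ≤ N → Real.exp (-(c * Real.sqrt N)) * Real.exp logMuTri ^ N ≤ #(triSLx N x)) :
    ∃ a > (0 : ℝ), ∃ C ≥ (0 : ℝ), ∃ N₂ : ℕ, ∀ N, N₂ ≤ N → 1 ≤ N →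
      (#((triSLx N x).filter fun ω => (#(triSharp ω) : ℝ) < a * N) : ℝ) ≤ C * #(triSLx N x) / (N : ℝ) ^ 3 := by
  classical
  obtain ⟨Q, hQ, C₀, hC₀⟩ := detourDensityTri
  have hQr : (0 : ℝ) < Q := by exact_mod_cast hQ
  obtain ⟨N₂, hN₂⟩ := exists_tail_le_one hQ hc
  refine ⟨1 / (4 * Q), by positivity, max C₀ 0, le_max_right _ _, max N₁ N₂, fun N hN hN1 => ?_⟩
  have hNr : (0 : ℝ) < N := by exact_mod_cast hN1
  -- Step 1: the filter (over `S_N(x)`) is contained in the all-walk density event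
  have hsub : #((triSLx N x).filter fun ω => (#(triSharp ω) : ℝ) < 1 / (4 * (Q : ℝ)) * N) ≤
      {l : List (Site 2) | l ∈ sawLists triGraph (0 : Site 2) N ∧ detourCount l ≤ N / (4 * Q)}.ncard := by
    rw [← Set.ncard_coe_finset]
    refine Set.ncard_le_ncard ?_ ((sawLists_finite triGraph (0 : Site 2) N).subset fun l hl => hl.1)
    intro ω hω
    rw [Finset.coe_filter, Set.mem_setOf_eq, mem_triSLx, mem_triSL] at hω
    refine ⟨hω.1.1, ?_⟩
    rw [← card_triSharp_eq_detourCount, Nat.le_div_iff_mul_le (by positivity)]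
    have h' := hω.2
    rw [div_mul_eq_mul_div, one_mul, lt_div_iff₀ (by positivity)] at h'
    exact_mod_cast h'.le
  -- Step 2: the density bound, the envelope and the tail
  have hhalf : (0 : ℝ) ≤ (1 / 2 : ℝ) ^ (N / Q) := by positivity
  have hμ : (0 : ℝ) ≤ Real.exp logMuTri ^ N := by positivity
  have henv : Real.exp logMuTri ^ N ≤ Real.exp (c * Real.sqrt N) * #(triSLx N x) := by
    have h := hlo N (le_trans (le_max_left _ _) hN)
    have he : Real.exp (c * Real.sqrt N) * (Real.exp (-(c * Real.sqrt N)) * Real.exp logMuTri ^ N) =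
        Real.exp logMuTri ^ N := by
      rw [← mul_assoc, ← Real.exp_add, add_neg_cancel, Real.exp_zero, one_mul]
    rw [← he]
    exact mul_le_mul_of_nonneg_left h (Real.exp_nonneg _)
  have htail := hN₂ N (le_trans (le_max_right _ _) hN) hN1
  have hW : (0 : ℝ) ≤ #(triSLx N x) := Nat.cast_nonneg _
  have hN3 : (0 : ℝ) < (N : ℝ) ^ 3 := by positivity
  calc (#((triSLx N x).filter fun ω => (#(triSharp ω) : ℝ) < 1 / (4 * (Q : ℝ)) * N) : ℝ)
      ≤ (({l : List (Site 2) | l ∈ sawLists triGraph (0 : Site 2) N ∧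
          detourCount l ≤ N / (4 * Q)}.ncard : ℕ) : ℝ) := by exact_mod_cast hsub
    _ ≤ C₀ * (1 / 2 : ℝ) ^ (N / Q) * Real.exp logMuTri ^ N := hC₀ N
    _ ≤ max C₀ 0 * (1 / 2 : ℝ) ^ (N / Q) * Real.exp logMuTri ^ N :=
        mul_le_mul_of_nonneg_right (mul_le_mul_of_nonneg_right (le_max_left _ _) hhalf) hμ
    _ ≤ max C₀ 0 * (1 / 2 : ℝ) ^ (N / Q) * (Real.exp (c * Real.sqrt N) * #(triSLx N x)) :=
        mul_le_mul_of_nonneg_left henv (mul_nonneg (le_max_right _ _) hhalf)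
    _ = max C₀ 0 * #(triSLx N x) * (((1 / 2 : ℝ) ^ (N / Q) * Real.exp (c * Real.sqrt N) * (N : ℝ) ^ 3) /
          (N : ℝ) ^ 3) := by field_simp
    _ ≤ max C₀ 0 * #(triSLx N x) * (1 / (N : ℝ) ^ 3) := by
        refine mul_le_mul_of_nonneg_left (div_le_div_of_nonneg_right htail hN3.le) (by positivity)
    _ = max C₀ 0 * #(triSLx N x) / (N : ℝ) ^ 3 := by ring

/-! ### Kesten's inequality for the fixed-endpoint family -/

/-- **Kesten's inequality for `c_N(0,x)` on `𝕋` from a lower envelope**: there is `D` with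
`φ_N(x)² − D/N ≤ φ_N(x) φ_{N+1}(x)` for all large `N`, `φ_N(x) = c_{N+1}(0,x)/c_N(0,x)` — the abstract inequality without
growth hypothesis fed with the fixed-endpoint transfer counts (P1), (P2) and the density (P3).
[cite: MadrasSlade1993, Theorem 7.3.2(c) (proof) and Theorem 7.3.4(b)] -/
theorem kestenIneqTriEndpoint_of (x : Site 2) {c : ℝ} (hc : 0 ≤ c) {N₁ : ℕ}
    (hlo : ∀ N : ℕ, N₁ ≤ N → Real.exp (-(c * Real.sqrt N)) * Real.exp logMuTri ^ N ≤ #(triSLx N x)) :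
    ∃ D : ℝ, ∀ᶠ N : ℕ in atTop,
      ((#(triSLx (N + 1) x) : ℝ) / #(triSLx N x)) ^ 2 - D / N ≤
        ((#(triSLx (N + 1) x) : ℝ) / #(triSLx N x)) * ((#(triSLx (N + 2) x) : ℝ) / #(triSLx (N + 1) x)) := by
  obtain ⟨a, ha, C, hC0, N₂, hC⟩ := triEndpointKesten_P3_of x hc hlo
  have hpos : ∀ N, max N₁ N₂ ≤ N → 0 < #(triSLx N x) := by
    intro N hN
    have h := hlo N (le_trans (le_max_left _ _) hN)
    have h0 : (0 : ℝ) < Real.exp (-(c * Real.sqrt N)) * Real.exp logMuTri ^ N := by positivity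
    have : (0 : ℝ) < #(triSLx N x) := lt_of_lt_of_le h0 h
    exact_mod_cast this
  exact kesten_ineq_of_transfer_noGrowth (α := List (Site 2)) (fun N => triSLx N x) (fun _ ω => #(triSlots ω))
    (fun _ ω => #(triSharp ω)) (max N₁ N₂) (a := a) (C := C) (c₁ := 2) (c₂ := 8) (c₃ := 5) (c₄ := 2)
    ha hC0 (by norm_num) (by norm_num) (by norm_num) (by norm_num) hpos
    (fun N _ ω hω => by
      have h := card_triSlots_le (triSL_of_mem_triSLx hω)
      calc ((#(triSlots ω) : ℕ) : ℝ) ≤ ((2 * N : ℕ) : ℝ) := by exact_mod_cast h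
        _ = 2 * (N : ℝ) := by push_cast; ring)
    (fun N _ => triEndpointKesten_P1' N x)
    (fun N _ => by
      refine le_trans (sum_le_sum fun ω _ => ?_) (triEndpointKesten_P2 N x)
      set I : ℝ := (#(triSlots ω) : ℝ)
      set J : ℝ := (#(triSharp ω) : ℝ)
      have hI0 : 0 ≤ I := Nat.cast_nonneg _
      have hJ0 : 0 ≤ J := Nat.cast_nonneg _
      have hden : 0 < (J + 3) * (J + 6) := by positivity
      have hden' : 0 < (J + 5) * (J + 5 + 1) := by positivity
      by_cases h8 : 8 ≤ I
      · have hmax : max 0 (I - 8) = I - 8 := max_eq_right (by linarith)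
        rw [hmax]
        apply div_le_div_of_nonneg_left (by nlinarith) hden
        nlinarith
      · have hneg : I * (I - 8) / ((J + 5) * (J + 5 + 1)) ≤ 0 :=
          div_nonpos_of_nonpos_of_nonneg (by nlinarith) hden'.le
        have hpos' : 0 ≤ I * max 0 (I - 8) / ((J + 3) * (J + 6)) := by positivity
        linarith)
    (fun N hN h1 => hC N (le_trans (le_max_right _ _) hN) h1)

/-! ### The ratio limit, conditional form (Madras–Slade Theorem 7.3.4(b) on `𝕋`) -/

/-- **`c_{N+1}(0,x)/c_N(0,x) → μ(𝕋)`, conditional form**: from a lower envelope `e^{−c√N} μ(𝕋)^N ≤ c_N(0,x)` (`N ≥ N₁`) and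
the root limit `c_N(0,x)^{1/N} → μ(𝕋)` — the two Corollary-3.2.6 inputs the lane's TRI-SAP line supplies — Kesten's one-step
ratio limit for the walks of `𝕋` from `0` to `x` follows by Lemma 7.3.1 (`Zd.tendsto_ratio_of_kesten_one`, on the sequence
shifted by `N₁` so that all terms are positive) with (ii) from `card_triSLx_le_four_mul` and (iii) from
`kestenIneqTriEndpoint_of`. [cite: MadrasSlade1993, Theorem 7.3.4(b) and Lemma 7.3.1] -/
theorem tendsto_card_triSLx_ratio_of (x : Site 2) {c : ℝ} (hc : 0 ≤ c) {N₁ : ℕ}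
    (hlo : ∀ N : ℕ, N₁ ≤ N → Real.exp (-(c * Real.sqrt N)) * Real.exp logMuTri ^ N ≤ #(triSLx N x))
    (hlim : Tendsto (fun N : ℕ => (#(triSLx (N + N₁) x) : ℝ) ^ (1 / (N : ℝ))) atTop (𝓝 (Real.exp logMuTri))) :
    Tendsto (fun N : ℕ => (#(triSLx (N + 1) x) : ℝ) / #(triSLx N x)) atTop (𝓝 (Real.exp logMuTri)) := by
  -- positivity beyond `N₁`
  have hpos : ∀ N, N₁ ≤ N → (0 : ℝ) < #(triSLx N x) := by
    intro N hN
    have h := hlo N hN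
    have h0 : (0 : ℝ) < Real.exp (-(c * Real.sqrt N)) * Real.exp logMuTri ^ N := by positivity
    exact lt_of_lt_of_le h0 h
  -- the shifted sequence
  set a : ℕ → ℝ := fun n => (#(triSLx (n + N₁) x) : ℝ) with hadef
  have ha : ∀ n, 0 < a n := fun n => hpos _ (by omega)
  -- (ii) on the shifted sequence: `a (n+1)/a n ≥ 1/4` eventually
  obtain ⟨N₀, hmono⟩ := exists_card_triSLx_le_four_mul x
  have hii : ∃ c' : ℝ, 0 < c' ∧ ∀ᶠ n in atTop, c' ≤ a (n + 1) / a n := by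
    refine ⟨1 / 4, by norm_num, ?_⟩
    rw [Filter.eventually_atTop]
    refine ⟨N₀, fun n hn => ?_⟩
    rw [le_div_iff₀ (ha n), hadef]
    dsimp only
    have h := hmono (n + N₁) (by omega)
    rw [show n + 1 + N₁ = n + N₁ + 1 by ring]
    have h' : ((#(triSLx (n + N₁) x) : ℕ) : ℝ) ≤ 4 * (#(triSLx (n + N₁ + 1) x) : ℝ) := by exact_mod_cast h
    linarith
  -- (iii) on the shifted sequence
  obtain ⟨D, hD⟩ := kestenIneqTriEndpoint_of x hc hlo
  have hiii : ∃ D' : ℝ, ∀ᶠ n in atTop,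
      (a (n + 1) / a n) ^ 2 - D' / n ≤ (a (n + 1) / a n) * (a (n + 2) / a (n + 1)) := by
    refine ⟨max D 0, ?_⟩
    rw [Filter.eventually_atTop] at hD ⊢
    obtain ⟨M, hM⟩ := hD
    refine ⟨max M 1, fun n hn => ?_⟩
    have hn1 : 1 ≤ n := le_trans (le_max_right _ _) hn
    have h := hM (n + N₁) (by omega)
    rw [hadef]; dsimp only
    rw [show n + 1 + N₁ = n + N₁ + 1 by ring, show n + 2 + N₁ = n + N₁ + 2 by ring]
    have hn0 : (0 : ℝ) < n := by exact_mod_cast hn1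
    have hnn : (n : ℝ) ≤ ((n + N₁ : ℕ) : ℝ) := by exact_mod_cast Nat.le_add_right n N₁
    have hD' : D / ((n + N₁ : ℕ) : ℝ) ≤ max D 0 / n := by
      calc D / ((n + N₁ : ℕ) : ℝ) ≤ max D 0 / ((n + N₁ : ℕ) : ℝ) :=
            div_le_div_of_nonneg_right (le_max_left _ _) (by positivity)
        _ ≤ max D 0 / n := div_le_div_of_nonneg_left (le_max_right _ _) hn0 hnn
    linarith
  have hshift := Zd.tendsto_ratio_of_kesten_one (Real.exp_pos _) ha hlim hii hiii
  -- unshift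
  rw [hadef] at hshift
  have e : (fun n : ℕ => (#(triSLx (n + 1 + N₁) x) : ℝ) / #(triSLx (n + N₁) x)) =
      fun n => (fun N => (#(triSLx (N + 1) x) : ℝ) / #(triSLx N x)) (n + N₁) := by
    funext n; simp only [show n + 1 + N₁ = n + N₁ + 1 by ring]
  rw [e] at hshift
  exact (Filter.tendsto_add_atTop_iff_nat N₁).1 hshift

/-! ### The root limit from the envelope, and the ratio limit from the envelope alone -/

/-- `#S_N(x) ≤ c_N(𝕋)`. [cite: MadrasSlade1993, §1.1] -/
theorem card_triSLx_le_triSawCount (N : ℕ) (x : Site 2) : #(triSLx N x) ≤ triSawCount N := by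
  rw [← card_triSL N]
  exact Finset.card_le_card (Finset.filter_subset _ _)

/-- **Root limit from the envelope** (Madras–Slade Corollary 3.2.6 on `𝕋`, conditional form): if
`e^{−c√N} μ(𝕋)^N ≤ c_N(0,x)` for `N ≥ N₁`, then `c_{N+N₁}(0,x)^{1/N} → μ(𝕋)` — squeezed between
`(e^{−c√(1+N₁)·√N} μ^N)^{1/N} → μ` and `(c_{N₁}(𝕋) c_N(𝕋))^{1/N} → μ`. [cite: MadrasSlade1993, Corollary 3.2.6] -/
theorem tendsto_card_triSLx_rpow_of (x : Site 2) {c : ℝ} (hc : 0 ≤ c) {N₁ : ℕ}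
    (hlo : ∀ N : ℕ, N₁ ≤ N → Real.exp (-(c * Real.sqrt N)) * Real.exp logMuTri ^ N ≤ #(triSLx N x)) :
    Tendsto (fun N : ℕ => (#(triSLx (N + N₁) x) : ℝ) ^ (1 / (N : ℝ))) atTop (𝓝 (Real.exp logMuTri)) := by
  set μ := Real.exp logMuTri with hμdef
  have hμ0 : 0 < μ := Real.exp_pos _
  have hμ1 : 1 ≤ μ := Real.one_le_exp ((Real.log_nonneg (le_add_of_nonneg_right (Real.sqrt_nonneg 5))).trans
    log_one_add_sqrt_five_le_logMuTri)
  set c' : ℝ := c * Real.sqrt (1 + N₁) with hc'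
  -- lower envelope of the shifted sequence, unshifted shape
  have hlow : ∀ N : ℕ, 1 ≤ N → Real.exp (-(c' * Real.sqrt N)) * μ ^ N ≤ #(triSLx (N + N₁) x) := by
    intro N hN
    have h := hlo (N + N₁) (by omega)
    have hN0 : (0 : ℝ) ≤ N := Nat.cast_nonneg N
    have hsq : Real.sqrt ((N + N₁ : ℕ) : ℝ) ≤ Real.sqrt (1 + N₁) * Real.sqrt N := by
      rw [← Real.sqrt_mul (by positivity)]
      refine Real.sqrt_le_sqrt ?_
      push_cast
      have : (N₁ : ℝ) ≤ N₁ * N := by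
        have h1 : (1 : ℝ) ≤ N := by exact_mod_cast hN
        have h0 : (0 : ℝ) ≤ N₁ := Nat.cast_nonneg N₁
        nlinarith
      nlinarith
    have hexp : Real.exp (-(c' * Real.sqrt N)) ≤ Real.exp (-(c * Real.sqrt ((N + N₁ : ℕ) : ℝ))) := by
      rw [Real.exp_le_exp, neg_le_neg_iff, hc', mul_assoc]
      exact mul_le_mul_of_nonneg_left hsq hc
    have hpow : μ ^ N ≤ μ ^ (N + N₁) := pow_le_pow_right₀ hμ1 (by omega)
    calc Real.exp (-(c' * Real.sqrt N)) * μ ^ N ≤ Real.exp (-(c * Real.sqrt ((N + N₁ : ℕ) : ℝ))) * μ ^ (N + N₁) :=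
          mul_le_mul hexp hpow (pow_nonneg hμ0.le _) (Real.exp_pos _).le
      _ ≤ #(triSLx (N + N₁) x) := h
  -- upper: `#S_{N+N₁}(x) ≤ c_{N₁}(𝕋) · c_N(𝕋)`
  have hup : ∀ N : ℕ, (#(triSLx (N + N₁) x) : ℝ) ≤ (triSawCount N₁ : ℝ) * triSawCount N := by
    intro N
    have h1 := card_triSLx_le_triSawCount (N + N₁) x
    have h2 := triSawCount_add_le N N₁
    have : #(triSLx (N + N₁) x) ≤ triSawCount N₁ * triSawCount N := by
      calc #(triSLx (N + N₁) x) ≤ triSawCount (N + N₁) := h1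
        _ ≤ triSawCount N * triSawCount N₁ := h2
        _ = triSawCount N₁ * triSawCount N := Nat.mul_comm _ _
    exact_mod_cast this
  -- the constant factor `c_{N₁}(𝕋)^{1/N} → 1`
  have hA : (0 : ℝ) < triSawCount N₁ := by exact_mod_cast one_le_triSawCount N₁
  have hconst : Tendsto (fun N : ℕ => (triSawCount N₁ : ℝ) ^ (1 / (N : ℝ))) atTop (𝓝 1) := by
    have h1 : Tendsto (fun N : ℕ => Real.log (triSawCount N₁) * (1 / (N : ℝ))) atTop (𝓝 0) := by
      have h := (tendsto_const_div_atTop_nhds_zero_nat (Real.log (triSawCount N₁)))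
      refine h.congr fun N => ?_
      rw [mul_one_div]
    have h2 := (Real.continuous_exp.tendsto 0).comp h1
    rw [Real.exp_zero] at h2
    refine h2.congr fun N => ?_
    rw [Function.comp_apply, Real.rpow_def_of_pos hA]
  have hupper : Tendsto (fun N : ℕ => ((triSawCount N₁ : ℝ) * triSawCount N) ^ (1 / (N : ℝ))) atTop (𝓝 μ) := by
    have h := hconst.mul tendsto_triSawCount_rpow
    rw [one_mul] at h
    refine h.congr fun N => ?_
    rw [← Real.mul_rpow hA.le (Nat.cast_nonneg _)]
  refine tendsto_of_tendsto_of_tendsto_of_le_of_le' (Zd.EndpointRatio.tendsto_lower_root (c := c') hμ0) hupper ?_ ?_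
  · filter_upwards [eventually_ge_atTop 1] with N hN
    exact Real.rpow_le_rpow (by positivity) (hlow N hN) (by positivity)
  · filter_upwards [eventually_ge_atTop 1] with N hN
    exact Real.rpow_le_rpow (by positivity) (hup N) (by positivity)

/-- **`c_{N+1}(0,x)/c_N(0,x) → μ(𝕋)` from the lower envelope alone** (Madras–Slade Theorem 7.3.4(b) on `𝕋`, one
step, conditional on `e^{−c√N} μ(𝕋)^N ≤ c_N(0,x)` for `N ≥ N₁` — the Corollary-3.2.6 envelope, which the lane's
polygon-insertion line supplies): the root limit is `tendsto_card_triSLx_rpow_of`, the rest is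
`tendsto_card_triSLx_ratio_of`. [cite: MadrasSlade1993, Theorem 7.3.4(b), Corollary 3.2.6 and Lemma 7.3.1] -/
theorem tendsto_card_triSLx_ratio_of_envelope (x : Site 2) {c : ℝ} (hc : 0 ≤ c) {N₁ : ℕ}
    (hlo : ∀ N : ℕ, N₁ ≤ N → Real.exp (-(c * Real.sqrt N)) * Real.exp logMuTri ^ N ≤ #(triSLx N x)) :
    Tendsto (fun N : ℕ => (#(triSLx (N + 1) x) : ℝ) / #(triSLx N x)) atTop (𝓝 (Real.exp logMuTri)) :=
  tendsto_card_triSLx_ratio_of x hc hlo (tendsto_card_triSLx_rpow_of x hc hlo)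

end Literature.Probability.RandomPlanarGeometry.SAW
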